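import Mathlib.Data.Real.Basic
import Mathlib.Order.Basic
import Mathlib.Tactic.Linarith
import Mathlib.Tactic.Ring
import Mathlib.Tactic.Positivity
import Mathlib.Tactic.FieldSimp
import HarnessLib
import HarnessLib.Audit

/-!
# `NoHeavyLowerTail` (crux stmt-CriticalPhenomena-4575), Sahi programme P4 (Holley / monotone coupling):
# FKG slot-locality at two join-primes — the real inequality behind it, I: the bilinear form on increments

Support file (cell `prim-l12`, seat P4, generation 6; `--supports stmt-CriticalPhenomena-4575`).  No named facts, no sorries;
standard axioms.  Pure real algebra: the lattice theorem that uses it is `…SahiE3TwoPrimeSlot`.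

## What is proved

Index a four-element Boolean pattern `M = {0, 1, 2, 3}` (`0` bottom, `1, 2` the two atoms, `3` top).  Think of `ν_t ≥ 0` as the
masses of the four fibres of a finite distributive lattice `L` over `M` (the fibres of `x ↦ (j₁ ≤ x, j₂ ≤ x)` for two join-prime
elements), of `α_t, β_t, γ_t` as the conditional densities in fibre `t` of up-sets `A`, `B`, `A ∩ B`, and of `U = ` fibres
`1 ∪ 2 ∪ 3` (`= ↑j₁ ∪ ↑j₂`).  Then Sahi's functional `Z³·E₃(1_U, 1_A, 1_B)` is the cubic `phiD` below, and the consequences of the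
four functions theorem available on such data are: `ν₁ν₂ ≤ ν₀ν₃` (the push-forward is FKG), `α, β` increasing along
`0 ≤ 1, 2 ≤ 3` (Holley), `γ_t ≥ γ_0` (Holley for `A ∩ B`) and `γ_t ≥ α_tβ_t` (FKG inside fibre `t`).

* `phiD_nonneg` — **under exactly these hypotheses `phiD ≥ 0`.**  This is the whole analytic content of the slot-locality theorem
  `E₃(↑j₁ ∪ ↑j₂, A, B) ≥ 0` for every FKG weight on every finite distributive lattice (`…SahiE3TwoPrimeSlot`).
* `phiM_nonneg` — the same in MASS form (`a_t = m(A ∩ F_t)` etc., hypotheses = Ahlswede–Daykin products), which is what the lattice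
  file instantiates; fibres of mass zero are handled here (phantom densities), so the lattice theorem needs no positivity of the weight.

## Proof (new; found and checked in this seat, HOME prim-l12-p4 gen 6)

(1) The coefficient of `γ_t` (`t ≠ 0`) in `phiD` is `Zν_t(Z+ν₀) ≥ 0` and that of `γ₀` is `−Zν₀u` (`u = ν₁+ν₂+ν₃`); split
`Zν_t(Z+ν₀) = W_t + T_t` with `T₁ = Zν₀(ν₁+E₁)`, `T₂ = Zν₀(ν₂+E₂)`, `T₃ = Zν₀(ν₃−E₁−E₂)` (so `Σ T_t = Zν₀u` kills `γ₀`) and use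
`γ_t ≥ α_tβ_t` against `W_t`, `γ_t ≥ γ₀` against `T_t`.  (2) What is left is, in the increments `x_t = α_t − α₀`, `y_t = β_t − β₀`,
the bilinear form `quadQ(x,y) = (Z+ν₀)[Z Σν_t x_t y_t − (Σν_t x_t)(Σ ν_t y_t)] − Zν₀ Σ(ν_t + ε_t) x_t y_t` (`ε = (E₁, E₂, −E₁−E₂)`)
plus the manifestly nonnegative `Zν₀α₀(E₁(y₃−y₁)+E₂(y₃−y₂)) + Zν₀β₀(E₁(x₃−x₁)+E₂(x₃−x₂))`.  (3) `quadQ ≥ 0` on pairs of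
nonnegative increasing `x, y` vanishing at `0`: such functions are nonnegative combinations of the indicators of the up-sets
`{1,2,3}, {1,3}, {2,3}, {3}`, `quadQ` is bilinear, and its ten values on pairs of generators are explicit nonnegative polynomials —
nine of them trivially, the tenth, `{1,3}` against `{2,3}`, equals `ν₀²ν₃ − (Z+ν₀)ν₁ν₂ + Zν₀(E₁+E₂)`, which is where the FKG
inequality `ν₁ν₂ ≤ ν₀ν₃` of the pattern measure enters.  (4) The shifts `E₁, E₂ ≥ 0` with `E₁+E₂ ≤ ν₃`, `ν₀E_t ≤ Zν_t` and
`(Z+ν₀)ν₁ν₂ ≤ ν₀²ν₃ + Zν₀(E₁+E₂)` exist (`exists_shift`): `E_t = ν₃ν_t/(ν₁+ν₂)` if `ν₀ν₃ ≤ Z(ν₁+ν₂)`, else `E_t = Zν_t/ν₀`.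
The inequality is tight (`phiD = 0`) on the product measures of `2²` with `A = ↑1`, `B = ↑2` and on all data with `β` constant,
which is why no fixed polynomial certificate of low degree exists (seat LPs: degree ≤ 4 with a linear multiplier infeasible) and
the shifts must depend on `ν`.
-/

namespace Summit.CriticalPhenomena.PercolationContinuityZ3.Theorems.SahiE3TwoPrimeSlot

/-! ### The bilinear form on increments and its values on generators -/

section GenValues

variable {ν₀ ν₁ ν₂ ν₃ E₁ E₂ : ℝ}

/-- `quadQ(1_{123}, 1_{123}) = ν₀²(ν₁+ν₂+ν₃) ≥ 0`. [this work] -/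
theorem genQ_UU (h1 : 0 ≤ ν₁) (h2 : 0 ≤ ν₂) (h3 : 0 ≤ ν₃) : 0 ≤ (((ν₀ + ν₁ + ν₂ + ν₃) + ν₀) * ((ν₀ + ν₁ + ν₂ + ν₃) * (ν₁ + ν₂ + ν₃) - (ν₁ + ν₂ + ν₃) * (ν₁ + ν₂ + ν₃)) - (ν₀ + ν₁ + ν₂ + ν₃) * ν₀ * (ν₁ + E₁ + (ν₂ + E₂) + (ν₃ - E₁ - E₂))) := by
  have e : (((ν₀ + ν₁ + ν₂ + ν₃) + ν₀) * ((ν₀ + ν₁ + ν₂ + ν₃) * (ν₁ + ν₂ + ν₃) - (ν₁ + ν₂ + ν₃) * (ν₁ + ν₂ + ν₃)) - (ν₀ + ν₁ + ν₂ + ν₃) * ν₀ * (ν₁ + E₁ + (ν₂ + E₂) + (ν₃ - E₁ - E₂)))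
      = ν₀ ^ 2 * (ν₁ + ν₂ + ν₃) := by ring
  rw [e]; positivity

/-- `quadQ(1_{123}, 1_{23}) = ν₀²(ν₂+ν₃) + Zν₀E₁ ≥ 0`. [this work] -/
theorem genQ_UP2 (h0 : 0 ≤ ν₀) (h1 : 0 ≤ ν₁) (h2 : 0 ≤ ν₂) (h3 : 0 ≤ ν₃) (hE1 : 0 ≤ E₁) : 0 ≤ (((ν₀ + ν₁ + ν₂ + ν₃) + ν₀) * ((ν₀ + ν₁ + ν₂ + ν₃) * (ν₂ + ν₃) - (ν₁ + ν₂ + ν₃) * (ν₂ + ν₃)) - (ν₀ + ν₁ + ν₂ + ν₃) * ν₀ * (ν₂ + E₂ + (ν₃ - E₁ - E₂))) := by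
  have e : (((ν₀ + ν₁ + ν₂ + ν₃) + ν₀) * ((ν₀ + ν₁ + ν₂ + ν₃) * (ν₂ + ν₃) - (ν₁ + ν₂ + ν₃) * (ν₂ + ν₃)) - (ν₀ + ν₁ + ν₂ + ν₃) * ν₀ * (ν₂ + E₂ + (ν₃ - E₁ - E₂)))
      = ν₀ ^ 2 * (ν₂ + ν₃) + (ν₀ + ν₁ + ν₂ + ν₃) * ν₀ * E₁ := by ring
  rw [e]; positivity

/-- `quadQ(1_{23}, 1_{123}) = ν₀²(ν₂+ν₃) + Zν₀E₁ ≥ 0`. [this work] -/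
theorem genQ_P2U (h0 : 0 ≤ ν₀) (h1 : 0 ≤ ν₁) (h2 : 0 ≤ ν₂) (h3 : 0 ≤ ν₃) (hE1 : 0 ≤ E₁) : 0 ≤ (((ν₀ + ν₁ + ν₂ + ν₃) + ν₀) * ((ν₀ + ν₁ + ν₂ + ν₃) * (ν₂ + ν₃) - (ν₂ + ν₃) * (ν₁ + ν₂ + ν₃)) - (ν₀ + ν₁ + ν₂ + ν₃) * ν₀ * (ν₂ + E₂ + (ν₃ - E₁ - E₂))) := by
  have e : (((ν₀ + ν₁ + ν₂ + ν₃) + ν₀) * ((ν₀ + ν₁ + ν₂ + ν₃) * (ν₂ + ν₃) - (ν₂ + ν₃) * (ν₁ + ν₂ + ν₃)) - (ν₀ + ν₁ + ν₂ + ν₃) * ν₀ * (ν₂ + E₂ + (ν₃ - E₁ - E₂)))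
      = ν₀ ^ 2 * (ν₂ + ν₃) + (ν₀ + ν₁ + ν₂ + ν₃) * ν₀ * E₁ := by ring
  rw [e]; positivity

/-- `quadQ(1_{123}, 1_{13}) = ν₀²(ν₁+ν₃) + Zν₀E₂ ≥ 0`. [this work] -/
theorem genQ_UP1 (h0 : 0 ≤ ν₀) (h1 : 0 ≤ ν₁) (h2 : 0 ≤ ν₂) (h3 : 0 ≤ ν₃) (hE2 : 0 ≤ E₂) : 0 ≤ (((ν₀ + ν₁ + ν₂ + ν₃) + ν₀) * ((ν₀ + ν₁ + ν₂ + ν₃) * (ν₁ + ν₃) - (ν₁ + ν₂ + ν₃) * (ν₁ + ν₃)) - (ν₀ + ν₁ + ν₂ + ν₃) * ν₀ * (ν₁ + E₁ + (ν₃ - E₁ - E₂))) := by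
  have e : (((ν₀ + ν₁ + ν₂ + ν₃) + ν₀) * ((ν₀ + ν₁ + ν₂ + ν₃) * (ν₁ + ν₃) - (ν₁ + ν₂ + ν₃) * (ν₁ + ν₃)) - (ν₀ + ν₁ + ν₂ + ν₃) * ν₀ * (ν₁ + E₁ + (ν₃ - E₁ - E₂)))
      = ν₀ ^ 2 * (ν₁ + ν₃) + (ν₀ + ν₁ + ν₂ + ν₃) * ν₀ * E₂ := by ring
  rw [e]; positivity

/-- `quadQ(1_{13}, 1_{123}) = ν₀²(ν₁+ν₃) + Zν₀E₂ ≥ 0`. [this work] -/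
theorem genQ_P1U (h0 : 0 ≤ ν₀) (h1 : 0 ≤ ν₁) (h2 : 0 ≤ ν₂) (h3 : 0 ≤ ν₃) (hE2 : 0 ≤ E₂) : 0 ≤ (((ν₀ + ν₁ + ν₂ + ν₃) + ν₀) * ((ν₀ + ν₁ + ν₂ + ν₃) * (ν₁ + ν₃) - (ν₁ + ν₃) * (ν₁ + ν₂ + ν₃)) - (ν₀ + ν₁ + ν₂ + ν₃) * ν₀ * (ν₁ + E₁ + (ν₃ - E₁ - E₂))) := by
  have e : (((ν₀ + ν₁ + ν₂ + ν₃) + ν₀) * ((ν₀ + ν₁ + ν₂ + ν₃) * (ν₁ + ν₃) - (ν₁ + ν₃) * (ν₁ + ν₂ + ν₃)) - (ν₀ + ν₁ + ν₂ + ν₃) * ν₀ * (ν₁ + E₁ + (ν₃ - E₁ - E₂)))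
      = ν₀ ^ 2 * (ν₁ + ν₃) + (ν₀ + ν₁ + ν₂ + ν₃) * ν₀ * E₂ := by ring
  rw [e]; positivity

/-- `quadQ(1_S, 1_{3}) = quadQ(1_{3}, 1_S)`-type values with intersection `{3}`: for `S = {123}`. [this work] -/
theorem genQ_UT (h0 : 0 ≤ ν₀) (h1 : 0 ≤ ν₁) (h2 : 0 ≤ ν₂) (h3 : 0 ≤ ν₃) (hE1 : 0 ≤ E₁) (hE2 : 0 ≤ E₂) : 0 ≤ (((ν₀ + ν₁ + ν₂ + ν₃) + ν₀) * ((ν₀ + ν₁ + ν₂ + ν₃) * ν₃ - (ν₁ + ν₂ + ν₃) * ν₃) - (ν₀ + ν₁ + ν₂ + ν₃) * ν₀ * (ν₃ - E₁ - E₂)) := by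
  have e : (((ν₀ + ν₁ + ν₂ + ν₃) + ν₀) * ((ν₀ + ν₁ + ν₂ + ν₃) * ν₃ - (ν₁ + ν₂ + ν₃) * ν₃) - (ν₀ + ν₁ + ν₂ + ν₃) * ν₀ * (ν₃ - E₁ - E₂)) = ν₀ ^ 2 * ν₃ + (ν₀ + ν₁ + ν₂ + ν₃) * ν₀ * (E₁ + E₂) := by
    ring
  rw [e]; positivity

/-- Intersection `{3}`, `S = {3}`, `S' = {123}`. [this work] -/
theorem genQ_TU (h0 : 0 ≤ ν₀) (h1 : 0 ≤ ν₁) (h2 : 0 ≤ ν₂) (h3 : 0 ≤ ν₃) (hE1 : 0 ≤ E₁) (hE2 : 0 ≤ E₂) : 0 ≤ (((ν₀ + ν₁ + ν₂ + ν₃) + ν₀) * ((ν₀ + ν₁ + ν₂ + ν₃) * ν₃ - ν₃ * (ν₁ + ν₂ + ν₃)) - (ν₀ + ν₁ + ν₂ + ν₃) * ν₀ * (ν₃ - E₁ - E₂)) := by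
  have e : (((ν₀ + ν₁ + ν₂ + ν₃) + ν₀) * ((ν₀ + ν₁ + ν₂ + ν₃) * ν₃ - ν₃ * (ν₁ + ν₂ + ν₃)) - (ν₀ + ν₁ + ν₂ + ν₃) * ν₀ * (ν₃ - E₁ - E₂)) = ν₀ ^ 2 * ν₃ + (ν₀ + ν₁ + ν₂ + ν₃) * ν₀ * (E₁ + E₂) := by
    ring
  rw [e]; positivity

/-- `quadQ(1_{23}, 1_{23}) = (ν₂+ν₃)(Zν₁ + ν₀² + ν₀ν₁) + Zν₀E₁ ≥ 0`. [this work] -/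
theorem genQ_P2P2 (h0 : 0 ≤ ν₀) (h1 : 0 ≤ ν₁) (h2 : 0 ≤ ν₂) (h3 : 0 ≤ ν₃) (hE1 : 0 ≤ E₁) : 0 ≤ (((ν₀ + ν₁ + ν₂ + ν₃) + ν₀) * ((ν₀ + ν₁ + ν₂ + ν₃) * (ν₂ + ν₃) - (ν₂ + ν₃) * (ν₂ + ν₃)) - (ν₀ + ν₁ + ν₂ + ν₃) * ν₀ * (ν₂ + E₂ + (ν₃ - E₁ - E₂))) := by
  have e : (((ν₀ + ν₁ + ν₂ + ν₃) + ν₀) * ((ν₀ + ν₁ + ν₂ + ν₃) * (ν₂ + ν₃) - (ν₂ + ν₃) * (ν₂ + ν₃)) - (ν₀ + ν₁ + ν₂ + ν₃) * ν₀ * (ν₂ + E₂ + (ν₃ - E₁ - E₂)))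
      = (ν₂ + ν₃) * ((ν₀ + ν₁ + ν₂ + ν₃) * ν₁ + ν₀ ^ 2 + ν₀ * ν₁) + (ν₀ + ν₁ + ν₂ + ν₃) * ν₀ * E₁ := by ring
  rw [e]; positivity

/-- `quadQ(1_{13}, 1_{13}) = (ν₁+ν₃)(Zν₂ + ν₀² + ν₀ν₂) + Zν₀E₂ ≥ 0`. [this work] -/
theorem genQ_P1P1 (h0 : 0 ≤ ν₀) (h1 : 0 ≤ ν₁) (h2 : 0 ≤ ν₂) (h3 : 0 ≤ ν₃) (hE2 : 0 ≤ E₂) : 0 ≤ (((ν₀ + ν₁ + ν₂ + ν₃) + ν₀) * ((ν₀ + ν₁ + ν₂ + ν₃) * (ν₁ + ν₃) - (ν₁ + ν₃) * (ν₁ + ν₃)) - (ν₀ + ν₁ + ν₂ + ν₃) * ν₀ * (ν₁ + E₁ + (ν₃ - E₁ - E₂))) := by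
  have e : (((ν₀ + ν₁ + ν₂ + ν₃) + ν₀) * ((ν₀ + ν₁ + ν₂ + ν₃) * (ν₁ + ν₃) - (ν₁ + ν₃) * (ν₁ + ν₃)) - (ν₀ + ν₁ + ν₂ + ν₃) * ν₀ * (ν₁ + E₁ + (ν₃ - E₁ - E₂)))
      = (ν₁ + ν₃) * ((ν₀ + ν₁ + ν₂ + ν₃) * ν₂ + ν₀ ^ 2 + ν₀ * ν₂) + (ν₀ + ν₁ + ν₂ + ν₃) * ν₀ * E₂ := by ring
  rw [e]; positivity

/-- `quadQ(1_{23}, 1_{3}) = ν₃(Zν₁ + ν₀² + ν₀ν₁) + Zν₀(E₁+E₂) ≥ 0`. [this work] -/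
theorem genQ_P2T (h0 : 0 ≤ ν₀) (h1 : 0 ≤ ν₁) (h2 : 0 ≤ ν₂) (h3 : 0 ≤ ν₃) (hE1 : 0 ≤ E₁) (hE2 : 0 ≤ E₂) : 0 ≤ (((ν₀ + ν₁ + ν₂ + ν₃) + ν₀) * ((ν₀ + ν₁ + ν₂ + ν₃) * ν₃ - (ν₂ + ν₃) * ν₃) - (ν₀ + ν₁ + ν₂ + ν₃) * ν₀ * (ν₃ - E₁ - E₂)) := by
  have e : (((ν₀ + ν₁ + ν₂ + ν₃) + ν₀) * ((ν₀ + ν₁ + ν₂ + ν₃) * ν₃ - (ν₂ + ν₃) * ν₃) - (ν₀ + ν₁ + ν₂ + ν₃) * ν₀ * (ν₃ - E₁ - E₂))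
      = ν₃ * ((ν₀ + ν₁ + ν₂ + ν₃) * ν₁ + ν₀ ^ 2 + ν₀ * ν₁) + (ν₀ + ν₁ + ν₂ + ν₃) * ν₀ * (E₁ + E₂) := by ring
  rw [e]; positivity

/-- `quadQ(1_{3}, 1_{23}) = ν₃(Zν₁ + ν₀² + ν₀ν₁) + Zν₀(E₁+E₂) ≥ 0`. [this work] -/
theorem genQ_TP2 (h0 : 0 ≤ ν₀) (h1 : 0 ≤ ν₁) (h2 : 0 ≤ ν₂) (h3 : 0 ≤ ν₃) (hE1 : 0 ≤ E₁) (hE2 : 0 ≤ E₂) : 0 ≤ (((ν₀ + ν₁ + ν₂ + ν₃) + ν₀) * ((ν₀ + ν₁ + ν₂ + ν₃) * ν₃ - ν₃ * (ν₂ + ν₃)) - (ν₀ + ν₁ + ν₂ + ν₃) * ν₀ * (ν₃ - E₁ - E₂)) := by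
  have e : (((ν₀ + ν₁ + ν₂ + ν₃) + ν₀) * ((ν₀ + ν₁ + ν₂ + ν₃) * ν₃ - ν₃ * (ν₂ + ν₃)) - (ν₀ + ν₁ + ν₂ + ν₃) * ν₀ * (ν₃ - E₁ - E₂))
      = ν₃ * ((ν₀ + ν₁ + ν₂ + ν₃) * ν₁ + ν₀ ^ 2 + ν₀ * ν₁) + (ν₀ + ν₁ + ν₂ + ν₃) * ν₀ * (E₁ + E₂) := by ring
  rw [e]; positivity

/-- `quadQ(1_{13}, 1_{3}) = ν₃(Zν₂ + ν₀² + ν₀ν₂) + Zν₀(E₁+E₂) ≥ 0`. [this work] -/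
theorem genQ_P1T (h0 : 0 ≤ ν₀) (h1 : 0 ≤ ν₁) (h2 : 0 ≤ ν₂) (h3 : 0 ≤ ν₃) (hE1 : 0 ≤ E₁) (hE2 : 0 ≤ E₂) : 0 ≤ (((ν₀ + ν₁ + ν₂ + ν₃) + ν₀) * ((ν₀ + ν₁ + ν₂ + ν₃) * ν₃ - (ν₁ + ν₃) * ν₃) - (ν₀ + ν₁ + ν₂ + ν₃) * ν₀ * (ν₃ - E₁ - E₂)) := by
  have e : (((ν₀ + ν₁ + ν₂ + ν₃) + ν₀) * ((ν₀ + ν₁ + ν₂ + ν₃) * ν₃ - (ν₁ + ν₃) * ν₃) - (ν₀ + ν₁ + ν₂ + ν₃) * ν₀ * (ν₃ - E₁ - E₂))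
      = ν₃ * ((ν₀ + ν₁ + ν₂ + ν₃) * ν₂ + ν₀ ^ 2 + ν₀ * ν₂) + (ν₀ + ν₁ + ν₂ + ν₃) * ν₀ * (E₁ + E₂) := by ring
  rw [e]; positivity

/-- `quadQ(1_{3}, 1_{13}) = ν₃(Zν₂ + ν₀² + ν₀ν₂) + Zν₀(E₁+E₂) ≥ 0`. [this work] -/
theorem genQ_TP1 (h0 : 0 ≤ ν₀) (h1 : 0 ≤ ν₁) (h2 : 0 ≤ ν₂) (h3 : 0 ≤ ν₃) (hE1 : 0 ≤ E₁) (hE2 : 0 ≤ E₂) : 0 ≤ (((ν₀ + ν₁ + ν₂ + ν₃) + ν₀) * ((ν₀ + ν₁ + ν₂ + ν₃) * ν₃ - ν₃ * (ν₁ + ν₃)) - (ν₀ + ν₁ + ν₂ + ν₃) * ν₀ * (ν₃ - E₁ - E₂)) := by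
  have e : (((ν₀ + ν₁ + ν₂ + ν₃) + ν₀) * ((ν₀ + ν₁ + ν₂ + ν₃) * ν₃ - ν₃ * (ν₁ + ν₃)) - (ν₀ + ν₁ + ν₂ + ν₃) * ν₀ * (ν₃ - E₁ - E₂))
      = ν₃ * ((ν₀ + ν₁ + ν₂ + ν₃) * ν₂ + ν₀ ^ 2 + ν₀ * ν₂) + (ν₀ + ν₁ + ν₂ + ν₃) * ν₀ * (E₁ + E₂) := by ring
  rw [e]; positivity

/-- `quadQ(1_{3}, 1_{3}) = ν₃((ν₀+ν₁+ν₂)² + (ν₁+ν₂)ν₃) + Zν₀(E₁+E₂) ≥ 0`. [this work] -/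
theorem genQ_TT (h0 : 0 ≤ ν₀) (h1 : 0 ≤ ν₁) (h2 : 0 ≤ ν₂) (h3 : 0 ≤ ν₃) (hE1 : 0 ≤ E₁) (hE2 : 0 ≤ E₂) : 0 ≤ (((ν₀ + ν₁ + ν₂ + ν₃) + ν₀) * ((ν₀ + ν₁ + ν₂ + ν₃) * ν₃ - ν₃ * ν₃) - (ν₀ + ν₁ + ν₂ + ν₃) * ν₀ * (ν₃ - E₁ - E₂)) := by
  have e : (((ν₀ + ν₁ + ν₂ + ν₃) + ν₀) * ((ν₀ + ν₁ + ν₂ + ν₃) * ν₃ - ν₃ * ν₃) - (ν₀ + ν₁ + ν₂ + ν₃) * ν₀ * (ν₃ - E₁ - E₂))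
      = ν₃ * ((ν₀ + ν₁ + ν₂) ^ 2 + (ν₁ + ν₂) * ν₃) + (ν₀ + ν₁ + ν₂ + ν₃) * ν₀ * (E₁ + E₂) := by ring
  rw [e]; positivity

/-- The one value that needs the FKG inequality of the pattern measure: `quadQ(1_{13}, 1_{23}) = ν₀²ν₃ − (Z+ν₀)ν₁ν₂ + Zν₀(E₁+E₂)`,
nonnegative under the shift condition `(Z+ν₀)ν₁ν₂ ≤ ν₀²ν₃ + Zν₀(E₁+E₂)`. [this work] -/
theorem genQ_P1P2 (hkey : (ν₀ + ν₁ + ν₂ + ν₃ + ν₀) * ν₁ * ν₂ ≤ ν₀ ^ 2 * ν₃ + (ν₀ + ν₁ + ν₂ + ν₃) * ν₀ * (E₁ + E₂)) :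
    0 ≤ (((ν₀ + ν₁ + ν₂ + ν₃) + ν₀) * ((ν₀ + ν₁ + ν₂ + ν₃) * ν₃ - (ν₁ + ν₃) * (ν₂ + ν₃)) - (ν₀ + ν₁ + ν₂ + ν₃) * ν₀ * (ν₃ - E₁ - E₂)) := by
  have e : (((ν₀ + ν₁ + ν₂ + ν₃) + ν₀) * ((ν₀ + ν₁ + ν₂ + ν₃) * ν₃ - (ν₁ + ν₃) * (ν₂ + ν₃)) - (ν₀ + ν₁ + ν₂ + ν₃) * ν₀ * (ν₃ - E₁ - E₂))
      = ν₀ ^ 2 * ν₃ + (ν₀ + ν₁ + ν₂ + ν₃) * ν₀ * (E₁ + E₂) - (ν₀ + ν₁ + ν₂ + ν₃ + ν₀) * ν₁ * ν₂ := by ring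
  rw [e]; linarith

/-- The same value with the generators exchanged. [this work] -/
theorem genQ_P2P1 (hkey : (ν₀ + ν₁ + ν₂ + ν₃ + ν₀) * ν₁ * ν₂ ≤ ν₀ ^ 2 * ν₃ + (ν₀ + ν₁ + ν₂ + ν₃) * ν₀ * (E₁ + E₂)) :
    0 ≤ (((ν₀ + ν₁ + ν₂ + ν₃) + ν₀) * ((ν₀ + ν₁ + ν₂ + ν₃) * ν₃ - (ν₂ + ν₃) * (ν₁ + ν₃)) - (ν₀ + ν₁ + ν₂ + ν₃) * ν₀ * (ν₃ - E₁ - E₂)) := by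
  have e : (((ν₀ + ν₁ + ν₂ + ν₃) + ν₀) * ((ν₀ + ν₁ + ν₂ + ν₃) * ν₃ - (ν₂ + ν₃) * (ν₁ + ν₃)) - (ν₀ + ν₁ + ν₂ + ν₃) * ν₀ * (ν₃ - E₁ - E₂))
      = ν₀ ^ 2 * ν₃ + (ν₀ + ν₁ + ν₂ + ν₃) * ν₀ * (E₁ + E₂) - (ν₀ + ν₁ + ν₂ + ν₃ + ν₀) * ν₁ * ν₂ := by ring
  rw [e]; linarith

end GenValues

/-! ### `quadQ ≥ 0` on pairs of nonnegative increasing increments -/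

/-- **The bilinear form is nonnegative on the cone.**  For `x, y ≥ 0` on `{1,2,3}` with `x₁, x₂ ≤ x₃`, `y₁, y₂ ≤ y₃` (increments of
increasing functions on the pattern `0 < 1, 2 < 3` vanishing at `0`), nonnegative pattern masses and shifts `E₁, E₂ ≥ 0` with
`(Z+ν₀)ν₁ν₂ ≤ ν₀²ν₃ + Zν₀(E₁+E₂)`: `quadQ ≥ 0`.  Proof: decompose `x, y` along the chains of generators through `1_{13}` or `1_{23}`
(according to `x₁ ≤ x₂` or not) and expand bilinearly; every one of the nine products is nonnegative. [this work] -/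
theorem quadQ_nonneg {ν₀ ν₁ ν₂ ν₃ E₁ E₂ x₁ x₂ x₃ y₁ y₂ y₃ : ℝ} (h0 : 0 ≤ ν₀) (h1 : 0 ≤ ν₁) (h2 : 0 ≤ ν₂) (h3 : 0 ≤ ν₃)
    (hE1 : 0 ≤ E₁) (hE2 : 0 ≤ E₂)
    (hkey : (ν₀ + ν₁ + ν₂ + ν₃ + ν₀) * ν₁ * ν₂ ≤ ν₀ ^ 2 * ν₃ + (ν₀ + ν₁ + ν₂ + ν₃) * ν₀ * (E₁ + E₂))
    (hx1 : 0 ≤ x₁) (hx2 : 0 ≤ x₂) (hx13 : x₁ ≤ x₃) (hx23 : x₂ ≤ x₃)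
    (hy1 : 0 ≤ y₁) (hy2 : 0 ≤ y₂) (hy13 : y₁ ≤ y₃) (hy23 : y₂ ≤ y₃) :
    0 ≤ (((ν₀ + ν₁ + ν₂ + ν₃) + ν₀) * ((ν₀ + ν₁ + ν₂ + ν₃) * (ν₁ * x₁ * y₁ + ν₂ * x₂ * y₂ + ν₃ * x₃ * y₃)
      - (ν₁ * x₁ + ν₂ * x₂ + ν₃ * x₃) * (ν₁ * y₁ + ν₂ * y₂ + ν₃ * y₃))
    - (ν₀ + ν₁ + ν₂ + ν₃) * ν₀ * ((ν₁ + E₁) * x₁ * y₁ + (ν₂ + E₂) * x₂ * y₂ + (ν₃ - E₁ - E₂) * x₃ * y₃)) := by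
  have gUU := @genQ_UU ν₀ ν₁ ν₂ ν₃ E₁ E₂ h1 h2 h3
  have gUP2 := @genQ_UP2 ν₀ ν₁ ν₂ ν₃ E₁ E₂ h0 h1 h2 h3 hE1
  have gP2U := @genQ_P2U ν₀ ν₁ ν₂ ν₃ E₁ E₂ h0 h1 h2 h3 hE1
  have gUP1 := @genQ_UP1 ν₀ ν₁ ν₂ ν₃ E₁ E₂ h0 h1 h2 h3 hE2
  have gP1U := @genQ_P1U ν₀ ν₁ ν₂ ν₃ E₁ E₂ h0 h1 h2 h3 hE2
  have gUT := @genQ_UT ν₀ ν₁ ν₂ ν₃ E₁ E₂ h0 h1 h2 h3 hE1 hE2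
  have gTU := @genQ_TU ν₀ ν₁ ν₂ ν₃ E₁ E₂ h0 h1 h2 h3 hE1 hE2
  have gP2P2 := @genQ_P2P2 ν₀ ν₁ ν₂ ν₃ E₁ E₂ h0 h1 h2 h3 hE1
  have gP1P1 := @genQ_P1P1 ν₀ ν₁ ν₂ ν₃ E₁ E₂ h0 h1 h2 h3 hE2
  have gP2T := @genQ_P2T ν₀ ν₁ ν₂ ν₃ E₁ E₂ h0 h1 h2 h3 hE1 hE2
  have gTP2 := @genQ_TP2 ν₀ ν₁ ν₂ ν₃ E₁ E₂ h0 h1 h2 h3 hE1 hE2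
  have gP1T := @genQ_P1T ν₀ ν₁ ν₂ ν₃ E₁ E₂ h0 h1 h2 h3 hE1 hE2
  have gTP1 := @genQ_TP1 ν₀ ν₁ ν₂ ν₃ E₁ E₂ h0 h1 h2 h3 hE1 hE2
  have gTT := @genQ_TT ν₀ ν₁ ν₂ ν₃ E₁ E₂ h0 h1 h2 h3 hE1 hE2
  have gP1P2 := @genQ_P1P2 ν₀ ν₁ ν₂ ν₃ E₁ E₂ hkey
  have gP2P1 := @genQ_P2P1 ν₀ ν₁ ν₂ ν₃ E₁ E₂ hkey
  rcases le_total x₁ x₂ with hx | hx <;> rcases le_total y₁ y₂ with hy | hy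
  · -- x along (123, 23, 3), y along (123, 23, 3)
    have e : (((ν₀ + ν₁ + ν₂ + ν₃) + ν₀) * ((ν₀ + ν₁ + ν₂ + ν₃) * (ν₁ * x₁ * y₁ + ν₂ * x₂ * y₂ + ν₃ * x₃ * y₃)
      - (ν₁ * x₁ + ν₂ * x₂ + ν₃ * x₃) * (ν₁ * y₁ + ν₂ * y₂ + ν₃ * y₃))
    - (ν₀ + ν₁ + ν₂ + ν₃) * ν₀ * ((ν₁ + E₁) * x₁ * y₁ + (ν₂ + E₂) * x₂ * y₂ + (ν₃ - E₁ - E₂) * x₃ * y₃)) =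
        x₁ * y₁ * (((ν₀ + ν₁ + ν₂ + ν₃) + ν₀) * ((ν₀ + ν₁ + ν₂ + ν₃) * (ν₁ + ν₂ + ν₃) - (ν₁ + ν₂ + ν₃) * (ν₁ + ν₂ + ν₃)) - (ν₀ + ν₁ + ν₂ + ν₃) * ν₀ * (ν₁ + E₁ + (ν₂ + E₂) + (ν₃ - E₁ - E₂)))
        + x₁ * (y₂ - y₁) * (((ν₀ + ν₁ + ν₂ + ν₃) + ν₀) * ((ν₀ + ν₁ + ν₂ + ν₃) * (ν₂ + ν₃) - (ν₁ + ν₂ + ν₃) * (ν₂ + ν₃)) - (ν₀ + ν₁ + ν₂ + ν₃) * ν₀ * (ν₂ + E₂ + (ν₃ - E₁ - E₂)))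
        + x₁ * (y₃ - y₂) * (((ν₀ + ν₁ + ν₂ + ν₃) + ν₀) * ((ν₀ + ν₁ + ν₂ + ν₃) * ν₃ - (ν₁ + ν₂ + ν₃) * ν₃) - (ν₀ + ν₁ + ν₂ + ν₃) * ν₀ * (ν₃ - E₁ - E₂))
        + (x₂ - x₁) * y₁ * (((ν₀ + ν₁ + ν₂ + ν₃) + ν₀) * ((ν₀ + ν₁ + ν₂ + ν₃) * (ν₂ + ν₃) - (ν₂ + ν₃) * (ν₁ + ν₂ + ν₃)) - (ν₀ + ν₁ + ν₂ + ν₃) * ν₀ * (ν₂ + E₂ + (ν₃ - E₁ - E₂)))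
        + (x₂ - x₁) * (y₂ - y₁) * (((ν₀ + ν₁ + ν₂ + ν₃) + ν₀) * ((ν₀ + ν₁ + ν₂ + ν₃) * (ν₂ + ν₃) - (ν₂ + ν₃) * (ν₂ + ν₃)) - (ν₀ + ν₁ + ν₂ + ν₃) * ν₀ * (ν₂ + E₂ + (ν₃ - E₁ - E₂)))
        + (x₂ - x₁) * (y₃ - y₂) * (((ν₀ + ν₁ + ν₂ + ν₃) + ν₀) * ((ν₀ + ν₁ + ν₂ + ν₃) * ν₃ - (ν₂ + ν₃) * ν₃) - (ν₀ + ν₁ + ν₂ + ν₃) * ν₀ * (ν₃ - E₁ - E₂))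
        + (x₃ - x₂) * y₁ * (((ν₀ + ν₁ + ν₂ + ν₃) + ν₀) * ((ν₀ + ν₁ + ν₂ + ν₃) * ν₃ - ν₃ * (ν₁ + ν₂ + ν₃)) - (ν₀ + ν₁ + ν₂ + ν₃) * ν₀ * (ν₃ - E₁ - E₂))
        + (x₃ - x₂) * (y₂ - y₁) * (((ν₀ + ν₁ + ν₂ + ν₃) + ν₀) * ((ν₀ + ν₁ + ν₂ + ν₃) * ν₃ - ν₃ * (ν₂ + ν₃)) - (ν₀ + ν₁ + ν₂ + ν₃) * ν₀ * (ν₃ - E₁ - E₂))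
        + (x₃ - x₂) * (y₃ - y₂) * (((ν₀ + ν₁ + ν₂ + ν₃) + ν₀) * ((ν₀ + ν₁ + ν₂ + ν₃) * ν₃ - ν₃ * ν₃) - (ν₀ + ν₁ + ν₂ + ν₃) * ν₀ * (ν₃ - E₁ - E₂)) := by
      ring
    rw [e]
    have d1 : 0 ≤ x₂ - x₁ := sub_nonneg.2 hx
    have d2 : 0 ≤ x₃ - x₂ := sub_nonneg.2 hx23
    have d3 : 0 ≤ y₂ - y₁ := sub_nonneg.2 hy
    have d4 : 0 ≤ y₃ - y₂ := sub_nonneg.2 hy23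
    linarith [mul_nonneg (mul_nonneg hx1 hy1) gUU, mul_nonneg (mul_nonneg hx1 d3) gUP2, mul_nonneg (mul_nonneg hx1 d4) gUT, mul_nonneg (mul_nonneg d1 hy1) gP2U, mul_nonneg (mul_nonneg d1 d3) gP2P2, mul_nonneg (mul_nonneg d1 d4) gP2T, mul_nonneg (mul_nonneg d2 hy1) gTU, mul_nonneg (mul_nonneg d2 d3) gTP2, mul_nonneg (mul_nonneg d2 d4) gTT]
  · -- x along (123, 23, 3), y along (123, 13, 3)
    have e : (((ν₀ + ν₁ + ν₂ + ν₃) + ν₀) * ((ν₀ + ν₁ + ν₂ + ν₃) * (ν₁ * x₁ * y₁ + ν₂ * x₂ * y₂ + ν₃ * x₃ * y₃)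
      - (ν₁ * x₁ + ν₂ * x₂ + ν₃ * x₃) * (ν₁ * y₁ + ν₂ * y₂ + ν₃ * y₃))
    - (ν₀ + ν₁ + ν₂ + ν₃) * ν₀ * ((ν₁ + E₁) * x₁ * y₁ + (ν₂ + E₂) * x₂ * y₂ + (ν₃ - E₁ - E₂) * x₃ * y₃)) =
        x₁ * y₂ * (((ν₀ + ν₁ + ν₂ + ν₃) + ν₀) * ((ν₀ + ν₁ + ν₂ + ν₃) * (ν₁ + ν₂ + ν₃) - (ν₁ + ν₂ + ν₃) * (ν₁ + ν₂ + ν₃)) - (ν₀ + ν₁ + ν₂ + ν₃) * ν₀ * (ν₁ + E₁ + (ν₂ + E₂) + (ν₃ - E₁ - E₂)))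
        + x₁ * (y₁ - y₂) * (((ν₀ + ν₁ + ν₂ + ν₃) + ν₀) * ((ν₀ + ν₁ + ν₂ + ν₃) * (ν₁ + ν₃) - (ν₁ + ν₂ + ν₃) * (ν₁ + ν₃)) - (ν₀ + ν₁ + ν₂ + ν₃) * ν₀ * (ν₁ + E₁ + (ν₃ - E₁ - E₂)))
        + x₁ * (y₃ - y₁) * (((ν₀ + ν₁ + ν₂ + ν₃) + ν₀) * ((ν₀ + ν₁ + ν₂ + ν₃) * ν₃ - (ν₁ + ν₂ + ν₃) * ν₃) - (ν₀ + ν₁ + ν₂ + ν₃) * ν₀ * (ν₃ - E₁ - E₂))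
        + (x₂ - x₁) * y₂ * (((ν₀ + ν₁ + ν₂ + ν₃) + ν₀) * ((ν₀ + ν₁ + ν₂ + ν₃) * (ν₂ + ν₃) - (ν₂ + ν₃) * (ν₁ + ν₂ + ν₃)) - (ν₀ + ν₁ + ν₂ + ν₃) * ν₀ * (ν₂ + E₂ + (ν₃ - E₁ - E₂)))
        + (x₂ - x₁) * (y₁ - y₂) * (((ν₀ + ν₁ + ν₂ + ν₃) + ν₀) * ((ν₀ + ν₁ + ν₂ + ν₃) * ν₃ - (ν₂ + ν₃) * (ν₁ + ν₃)) - (ν₀ + ν₁ + ν₂ + ν₃) * ν₀ * (ν₃ - E₁ - E₂))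
        + (x₂ - x₁) * (y₃ - y₁) * (((ν₀ + ν₁ + ν₂ + ν₃) + ν₀) * ((ν₀ + ν₁ + ν₂ + ν₃) * ν₃ - (ν₂ + ν₃) * ν₃) - (ν₀ + ν₁ + ν₂ + ν₃) * ν₀ * (ν₃ - E₁ - E₂))
        + (x₃ - x₂) * y₂ * (((ν₀ + ν₁ + ν₂ + ν₃) + ν₀) * ((ν₀ + ν₁ + ν₂ + ν₃) * ν₃ - ν₃ * (ν₁ + ν₂ + ν₃)) - (ν₀ + ν₁ + ν₂ + ν₃) * ν₀ * (ν₃ - E₁ - E₂))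
        + (x₃ - x₂) * (y₁ - y₂) * (((ν₀ + ν₁ + ν₂ + ν₃) + ν₀) * ((ν₀ + ν₁ + ν₂ + ν₃) * ν₃ - ν₃ * (ν₁ + ν₃)) - (ν₀ + ν₁ + ν₂ + ν₃) * ν₀ * (ν₃ - E₁ - E₂))
        + (x₃ - x₂) * (y₃ - y₁) * (((ν₀ + ν₁ + ν₂ + ν₃) + ν₀) * ((ν₀ + ν₁ + ν₂ + ν₃) * ν₃ - ν₃ * ν₃) - (ν₀ + ν₁ + ν₂ + ν₃) * ν₀ * (ν₃ - E₁ - E₂)) := by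
      ring
    rw [e]
    have d1 : 0 ≤ x₂ - x₁ := sub_nonneg.2 hx
    have d2 : 0 ≤ x₃ - x₂ := sub_nonneg.2 hx23
    have d3 : 0 ≤ y₁ - y₂ := sub_nonneg.2 hy
    have d4 : 0 ≤ y₃ - y₁ := sub_nonneg.2 hy13
    linarith [mul_nonneg (mul_nonneg hx1 hy2) gUU, mul_nonneg (mul_nonneg hx1 d3) gUP1, mul_nonneg (mul_nonneg hx1 d4) gUT, mul_nonneg (mul_nonneg d1 hy2) gP2U, mul_nonneg (mul_nonneg d1 d3) gP2P1, mul_nonneg (mul_nonneg d1 d4) gP2T, mul_nonneg (mul_nonneg d2 hy2) gTU, mul_nonneg (mul_nonneg d2 d3) gTP1, mul_nonneg (mul_nonneg d2 d4) gTT]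
  · -- x along (123, 13, 3), y along (123, 23, 3)
    have e : (((ν₀ + ν₁ + ν₂ + ν₃) + ν₀) * ((ν₀ + ν₁ + ν₂ + ν₃) * (ν₁ * x₁ * y₁ + ν₂ * x₂ * y₂ + ν₃ * x₃ * y₃)
      - (ν₁ * x₁ + ν₂ * x₂ + ν₃ * x₃) * (ν₁ * y₁ + ν₂ * y₂ + ν₃ * y₃))
    - (ν₀ + ν₁ + ν₂ + ν₃) * ν₀ * ((ν₁ + E₁) * x₁ * y₁ + (ν₂ + E₂) * x₂ * y₂ + (ν₃ - E₁ - E₂) * x₃ * y₃)) =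
        x₂ * y₁ * (((ν₀ + ν₁ + ν₂ + ν₃) + ν₀) * ((ν₀ + ν₁ + ν₂ + ν₃) * (ν₁ + ν₂ + ν₃) - (ν₁ + ν₂ + ν₃) * (ν₁ + ν₂ + ν₃)) - (ν₀ + ν₁ + ν₂ + ν₃) * ν₀ * (ν₁ + E₁ + (ν₂ + E₂) + (ν₃ - E₁ - E₂)))
        + x₂ * (y₂ - y₁) * (((ν₀ + ν₁ + ν₂ + ν₃) + ν₀) * ((ν₀ + ν₁ + ν₂ + ν₃) * (ν₂ + ν₃) - (ν₁ + ν₂ + ν₃) * (ν₂ + ν₃)) - (ν₀ + ν₁ + ν₂ + ν₃) * ν₀ * (ν₂ + E₂ + (ν₃ - E₁ - E₂)))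
        + x₂ * (y₃ - y₂) * (((ν₀ + ν₁ + ν₂ + ν₃) + ν₀) * ((ν₀ + ν₁ + ν₂ + ν₃) * ν₃ - (ν₁ + ν₂ + ν₃) * ν₃) - (ν₀ + ν₁ + ν₂ + ν₃) * ν₀ * (ν₃ - E₁ - E₂))
        + (x₁ - x₂) * y₁ * (((ν₀ + ν₁ + ν₂ + ν₃) + ν₀) * ((ν₀ + ν₁ + ν₂ + ν₃) * (ν₁ + ν₃) - (ν₁ + ν₃) * (ν₁ + ν₂ + ν₃)) - (ν₀ + ν₁ + ν₂ + ν₃) * ν₀ * (ν₁ + E₁ + (ν₃ - E₁ - E₂)))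
        + (x₁ - x₂) * (y₂ - y₁) * (((ν₀ + ν₁ + ν₂ + ν₃) + ν₀) * ((ν₀ + ν₁ + ν₂ + ν₃) * ν₃ - (ν₁ + ν₃) * (ν₂ + ν₃)) - (ν₀ + ν₁ + ν₂ + ν₃) * ν₀ * (ν₃ - E₁ - E₂))
        + (x₁ - x₂) * (y₃ - y₂) * (((ν₀ + ν₁ + ν₂ + ν₃) + ν₀) * ((ν₀ + ν₁ + ν₂ + ν₃) * ν₃ - (ν₁ + ν₃) * ν₃) - (ν₀ + ν₁ + ν₂ + ν₃) * ν₀ * (ν₃ - E₁ - E₂))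
        + (x₃ - x₁) * y₁ * (((ν₀ + ν₁ + ν₂ + ν₃) + ν₀) * ((ν₀ + ν₁ + ν₂ + ν₃) * ν₃ - ν₃ * (ν₁ + ν₂ + ν₃)) - (ν₀ + ν₁ + ν₂ + ν₃) * ν₀ * (ν₃ - E₁ - E₂))
        + (x₃ - x₁) * (y₂ - y₁) * (((ν₀ + ν₁ + ν₂ + ν₃) + ν₀) * ((ν₀ + ν₁ + ν₂ + ν₃) * ν₃ - ν₃ * (ν₂ + ν₃)) - (ν₀ + ν₁ + ν₂ + ν₃) * ν₀ * (ν₃ - E₁ - E₂))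
        + (x₃ - x₁) * (y₃ - y₂) * (((ν₀ + ν₁ + ν₂ + ν₃) + ν₀) * ((ν₀ + ν₁ + ν₂ + ν₃) * ν₃ - ν₃ * ν₃) - (ν₀ + ν₁ + ν₂ + ν₃) * ν₀ * (ν₃ - E₁ - E₂)) := by
      ring
    rw [e]
    have d1 : 0 ≤ x₁ - x₂ := sub_nonneg.2 hx
    have d2 : 0 ≤ x₃ - x₁ := sub_nonneg.2 hx13
    have d3 : 0 ≤ y₂ - y₁ := sub_nonneg.2 hy
    have d4 : 0 ≤ y₃ - y₂ := sub_nonneg.2 hy23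
    linarith [mul_nonneg (mul_nonneg hx2 hy1) gUU, mul_nonneg (mul_nonneg hx2 d3) gUP2, mul_nonneg (mul_nonneg hx2 d4) gUT, mul_nonneg (mul_nonneg d1 hy1) gP1U, mul_nonneg (mul_nonneg d1 d3) gP1P2, mul_nonneg (mul_nonneg d1 d4) gP1T, mul_nonneg (mul_nonneg d2 hy1) gTU, mul_nonneg (mul_nonneg d2 d3) gTP2, mul_nonneg (mul_nonneg d2 d4) gTT]
  · -- x along (123, 13, 3), y along (123, 13, 3)
    have e : (((ν₀ + ν₁ + ν₂ + ν₃) + ν₀) * ((ν₀ + ν₁ + ν₂ + ν₃) * (ν₁ * x₁ * y₁ + ν₂ * x₂ * y₂ + ν₃ * x₃ * y₃)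
      - (ν₁ * x₁ + ν₂ * x₂ + ν₃ * x₃) * (ν₁ * y₁ + ν₂ * y₂ + ν₃ * y₃))
    - (ν₀ + ν₁ + ν₂ + ν₃) * ν₀ * ((ν₁ + E₁) * x₁ * y₁ + (ν₂ + E₂) * x₂ * y₂ + (ν₃ - E₁ - E₂) * x₃ * y₃)) =
        x₂ * y₂ * (((ν₀ + ν₁ + ν₂ + ν₃) + ν₀) * ((ν₀ + ν₁ + ν₂ + ν₃) * (ν₁ + ν₂ + ν₃) - (ν₁ + ν₂ + ν₃) * (ν₁ + ν₂ + ν₃)) - (ν₀ + ν₁ + ν₂ + ν₃) * ν₀ * (ν₁ + E₁ + (ν₂ + E₂) + (ν₃ - E₁ - E₂)))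
        + x₂ * (y₁ - y₂) * (((ν₀ + ν₁ + ν₂ + ν₃) + ν₀) * ((ν₀ + ν₁ + ν₂ + ν₃) * (ν₁ + ν₃) - (ν₁ + ν₂ + ν₃) * (ν₁ + ν₃)) - (ν₀ + ν₁ + ν₂ + ν₃) * ν₀ * (ν₁ + E₁ + (ν₃ - E₁ - E₂)))
        + x₂ * (y₃ - y₁) * (((ν₀ + ν₁ + ν₂ + ν₃) + ν₀) * ((ν₀ + ν₁ + ν₂ + ν₃) * ν₃ - (ν₁ + ν₂ + ν₃) * ν₃) - (ν₀ + ν₁ + ν₂ + ν₃) * ν₀ * (ν₃ - E₁ - E₂))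
        + (x₁ - x₂) * y₂ * (((ν₀ + ν₁ + ν₂ + ν₃) + ν₀) * ((ν₀ + ν₁ + ν₂ + ν₃) * (ν₁ + ν₃) - (ν₁ + ν₃) * (ν₁ + ν₂ + ν₃)) - (ν₀ + ν₁ + ν₂ + ν₃) * ν₀ * (ν₁ + E₁ + (ν₃ - E₁ - E₂)))
        + (x₁ - x₂) * (y₁ - y₂) * (((ν₀ + ν₁ + ν₂ + ν₃) + ν₀) * ((ν₀ + ν₁ + ν₂ + ν₃) * (ν₁ + ν₃) - (ν₁ + ν₃) * (ν₁ + ν₃)) - (ν₀ + ν₁ + ν₂ + ν₃) * ν₀ * (ν₁ + E₁ + (ν₃ - E₁ - E₂)))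
        + (x₁ - x₂) * (y₃ - y₁) * (((ν₀ + ν₁ + ν₂ + ν₃) + ν₀) * ((ν₀ + ν₁ + ν₂ + ν₃) * ν₃ - (ν₁ + ν₃) * ν₃) - (ν₀ + ν₁ + ν₂ + ν₃) * ν₀ * (ν₃ - E₁ - E₂))
        + (x₃ - x₁) * y₂ * (((ν₀ + ν₁ + ν₂ + ν₃) + ν₀) * ((ν₀ + ν₁ + ν₂ + ν₃) * ν₃ - ν₃ * (ν₁ + ν₂ + ν₃)) - (ν₀ + ν₁ + ν₂ + ν₃) * ν₀ * (ν₃ - E₁ - E₂))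
        + (x₃ - x₁) * (y₁ - y₂) * (((ν₀ + ν₁ + ν₂ + ν₃) + ν₀) * ((ν₀ + ν₁ + ν₂ + ν₃) * ν₃ - ν₃ * (ν₁ + ν₃)) - (ν₀ + ν₁ + ν₂ + ν₃) * ν₀ * (ν₃ - E₁ - E₂))
        + (x₃ - x₁) * (y₃ - y₁) * (((ν₀ + ν₁ + ν₂ + ν₃) + ν₀) * ((ν₀ + ν₁ + ν₂ + ν₃) * ν₃ - ν₃ * ν₃) - (ν₀ + ν₁ + ν₂ + ν₃) * ν₀ * (ν₃ - E₁ - E₂)) := by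
      ring
    rw [e]
    have d1 : 0 ≤ x₁ - x₂ := sub_nonneg.2 hx
    have d2 : 0 ≤ x₃ - x₁ := sub_nonneg.2 hx13
    have d3 : 0 ≤ y₁ - y₂ := sub_nonneg.2 hy
    have d4 : 0 ≤ y₃ - y₁ := sub_nonneg.2 hy13
    linarith [mul_nonneg (mul_nonneg hx2 hy2) gUU, mul_nonneg (mul_nonneg hx2 d3) gUP1, mul_nonneg (mul_nonneg hx2 d4) gUT, mul_nonneg (mul_nonneg d1 hy2) gP1U, mul_nonneg (mul_nonneg d1 d3) gP1P1, mul_nonneg (mul_nonneg d1 d4) gP1T, mul_nonneg (mul_nonneg d2 hy2) gTU, mul_nonneg (mul_nonneg d2 d3) gTP1, mul_nonneg (mul_nonneg d2 d4) gTT]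

end Summit.CriticalPhenomena.PercolationContinuityZ3.Theorems.SahiE3TwoPrimeSlot
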